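import Summits.ResolutionOfSingularities.ResolutionOfSingularities.Theorems.WildQuotientsSummitReductionStubPairOrbitBlowupCentreNewLemmas
import Literature.AlgebraicGeometry.Resolution.AlterationsSemiStableCodimTwoThicknessDrop
import HarnessLib

/-!
# `WildQuotients.SummitReduction` (stmt-ResolutionOfSingularities-16324), line `FramePerfect`, skeleton v8:
# helper lemmas for stub `stub_pair_orbitBlowupCentreNew` (C3) — reading the thickness `n` off a
# base-compatible formal model (de Jong 1996, 3.4: "it is an invariant `n_T`", any field)

Route `ResolutionOfSingularities/WildQuotients`, crux `SummitReduction`; worker file supporting the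
registered stub `stub_pair_orbitBlowupCentreNew` of the line skeleton (v8, lead c4).

De Jong 1996, 3.4 (p. 63): "if `x ∈ T ⊂ X` and we write the complete local ring `B` of `X` in `x` as
in 3.3, then we see that the complete local ring of `T` at `x` corresponds to the quotient map
`B → A'/t₁A'` … This integer is independent of the choice of `x ∈ T`, i.e. it is an invariant `n_T`".
The tree reads the thickness `n(x') = ℓ(𝒪_{X',x'}/Fitt₁(Ω_{X'/Y}))` (`Scheme.Hom.nodeThickness`) of a
codimension-`≤ 2` singular point `x'` off a base-compatible formal model at a CLOSED specialization
`x'₁` over an algebraically closed field (the `hthick` blocks of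
`DeJong1996.SemiStablePair.exists_baseModel_codimTwo` and `….nodeThickness_blowup_add_two`,
`AlterationsSemiStableCodimTwoThicknessDrop.lean`). `centreNew_nodeThickness_eq_of_model` is that
computation with its two field-dependent inputs made hypotheses — the model
`Ψ : 𝒪̂_{X',x'₁} ≅ Â⟦u, v⟧/(uv - ∏ ŵᵢ^{νᵢ})` over `Â` with Cohen coordinates `ŵᵢ ↦ Tᵢ`, and "every germ at
`x'₁` is a germ of `𝒪_Y` modulo `𝔪`" — valid at any point over any field: the prime of `x'` completes
to some `(u, v, T_{i₁})` with `ν_{i₁} ≥ 2` and `q^#(w_{i₁}) ∈ 𝔭_{x'}` (3.4 ¶2,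
`codimTwo_map_adicCompletion_eq_triplePrime`), `Fitt₁ 𝒪̂ ↦ (u, v)` (2.23 Remark,
`NodeDeformationRing.map_fittingIdeal_eq_span`), and `n(x') = ℓ((M/(u, v))_{(u,v,T_{i₁})}) = ν_{i₁}`
(Stacks 02M1 along `𝒪_{X',x'} → M_{(u,v,T_{i₁})}`).
-/

set_option linter.dupNamespace false

noncomputable section

open CategoryTheory CategoryTheory.Limits AlgebraicGeometry TopologicalSpace Topology
open Literature.AlgebraicGeometry.Resolution
open Literature.AlgebraicGeometry
open IsLocalRing Scheme.IdealSheafData DeJong1996 DeJong1996.FormalNodeRing NodalDeformation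

namespace Summit.ResolutionOfSingularities.ResolutionOfSingularities.Theorems

universe u

set_option maxHeartbeats 1600000 in
/-- **The thickness read off a base-compatible formal model, any field.** Let `q : X' ⟶ Y` be
locally of finite type between locally Noetherian schemes, `x' ⤳ x'₁` with `x'` a codimension-`≤ 2`
singular point and `𝒪_{X',x'₁}` a G-ring, `w₁, …, w_m ∈ 𝒪_{Y,q x'₁}` with Cohen coordinates
`ι : 𝒪̂_Y ≅ K⟦T⟧`, `ŵᵢ ↦ Tᵢ`, a model `Ψ : 𝒪̂_{X',x'₁} ≅ Â⟦u, v⟧/(uv - ∏ ŵᵢ^{νᵢ})` over `Â`, and suppose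
every germ at `x'₁` is a germ of `𝒪_{Y,q x'₁}` modulo `𝔪_{x'₁}`. Then for some index `i₁` with
`ν_{i₁} ≥ 2` and `q^#(w_{i₁}) ∈ 𝔭_{x'}`: `n(x') = ν_{i₁}` (`Scheme.Hom.nodeThickness`).
[cite: DeJong1996, 3.4, pp. 63–64] -/
theorem centreNew_nodeThickness_eq_of_model {X' Y : Scheme.{u}} (q : X' ⟶ Y) [LocallyOfFiniteType q]
    [IsLocallyNoetherian X'] [IsLocallyNoetherian Y] {x' x'₁ : X'} (hsp' : x' ⤳ x'₁)
    (hx' : x' ∈ Scheme.singularLocusCodimLE X' 2) (hG' : IsGRing (X'.presheaf.stalk x'₁))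
    {K : Type u} [Field K] {m : ℕ} (w : Fin m → Y.presheaf.stalk (q x'₁)) (ν' : Fin m → ℕ)
    (ι : Cpl (Y.presheaf.stalk (q x'₁)) ≃+* MvPowerSeries (Fin m) K)
    (hι : ∀ i, ι (AdicCompletion.of (maximalIdeal (Y.presheaf.stalk (q x'₁))) _ (w i)) = MvPowerSeries.X i)
    (Ψ : Cpl (X'.presheaf.stalk x'₁) ≃+*
      NodeDeformationRing (Cpl (Y.presheaf.stalk (q x'₁)))
        (∏ i, AdicCompletion.of (maximalIdeal (Y.presheaf.stalk (q x'₁))) _ (w i) ^ ν' i))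
    (hΨof : ∀ a : Y.presheaf.stalk (q x'₁),
      Ψ (AdicCompletion.of (maximalIdeal (X'.presheaf.stalk x'₁)) (X'.presheaf.stalk x'₁)
          ((q.stalkMap x'₁).hom a)) =
        NodeDeformationRing.ofBase _ _ (AdicCompletion.of (maximalIdeal (Y.presheaf.stalk (q x'₁))) _ a))
    (hres : ∀ b : X'.presheaf.stalk x'₁, ∃ a : Y.presheaf.stalk (q x'₁),
      b - (q.stalkMap x'₁).hom a ∈ maximalIdeal (X'.presheaf.stalk x'₁)) :
    ∃ i₁ : Fin m, 2 ≤ ν' i₁ ∧ (q.stalkMap x'₁).hom (w i₁) ∈ primeOfSpecializes hsp' ∧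
      Scheme.Hom.nodeThickness q x' = ν' i₁ := by
  classical
  let R : Type u := X'.presheaf.stalk x'₁
  let R' : Type u := X'.presheaf.stalk x'
  let A : Type u := Y.presheaf.stalk (q x'₁)
  let Λ : Type u := Cpl A
  let φ' : A →+* R := (q.stalkMap x'₁).hom
  set P' : Ideal R := primeOfSpecializes hsp' with hP'def
  letI algP' : Algebra R R' := (X'.presheaf.stalkSpecializes hsp').hom.toAlgebra
  haveI hlocP' : IsLocalization.AtPrime R' P' := isLocalizationAtPrime_stalkSpecializes hsp'
  let eP' : Localization.AtPrime P' ≃ₐ[R] R' :=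
    IsLocalization.algEquiv P'.primeCompl (Localization.AtPrime P') R'
  have hP'reg : ¬ IsRegularLocalRing (Localization.AtPrime P') := fun h =>
    hx'.1 (IsRegularLocalRing.of_ringEquiv eP'.toRingEquiv)
  have hP'dim : ringKrullDim (Localization.AtPrime P') ≤ 2 := by
    rw [ringKrullDim_eq_of_ringEquiv eP'.toRingEquiv]
    exact hx'.2
  -- ### the Cohen form `eM' = Ψ ≫ E'` of the model
  have hιh' : ι (∏ i, AdicCompletion.of (maximalIdeal A) A (w i) ^ ν' i) = ∏ i, MvPowerSeries.X i ^ ν' i := by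
    rw [map_prod]
    exact Finset.prod_congr rfl fun i _ => by rw [map_pow, hι i]
  set E' : NodeDeformationRing Λ (∏ i, AdicCompletion.of (maximalIdeal A) A (w i) ^ ν' i) ≃+*
      FormalNodeRing K m ν' :=
    (NodeDeformationRing.congr ι _ _ hιh').trans (NodeDeformationRing.toFormalNodeRing K m ν') with hE'def
  set eM' : Cpl R ≃+* FormalNodeRing K m ν' := Ψ.trans E' with heM'
  have hof : ∀ r : R, algebraMap R (Cpl R) r = AdicCompletion.of (maximalIdeal R) R r := fun r => by
    rw [AdicCompletion.algebraMap_apply, Algebra.algebraMap_self_apply]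
  have het' : ∀ i, eM' (algebraMap R (Cpl R) (φ' (w i))) =
      Ideal.Quotient.mk _ (MvPowerSeries.X (Sum.inr i)) := by
    intro i
    rw [heM', RingEquiv.trans_apply, hof, hΨof (w i), hE'def, RingEquiv.trans_apply,
      NodeDeformationRing.ofBase_apply, NodeDeformationRing.congr_mk_C, hι i,
      NodeDeformationRing.toFormalNodeRing_mk_C_X]
  have hE'_X : ∀ j : Fin 2, E' (Ideal.Quotient.mk _ (MvPowerSeries.X j)) =
      Ideal.Quotient.mk _ (MvPowerSeries.X (Sum.inl j)) := by
    intro j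
    rw [hE'def, RingEquiv.trans_apply, NodeDeformationRing.congr_mk_X, NodeDeformationRing.toFormalNodeRing_mk_X]
  -- ### 3.4 ¶2 at the prime of `x'`: `Î_{x'} = (u, v, T_{i₁})`
  obtain ⟨i₁, hi₁, hti₁, hJ'⟩ :=
    codimTwo_map_adicCompletion_eq_triplePrime hG' eM' (fun i => φ' (w i)) het' P' hP'reg hP'dim
  refine ⟨i₁, hi₁, hti₁, ?_⟩
  -- ### `n(x') = ν'_{i₁}` along the flat local map `𝒪_{X',x'} → M'_{(u,v,T_{i₁})}`
  let M' := FormalNodeRing K m ν'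
  let c' : R →+* M' := eM'.toRingHom.comp (algebraMap R (Cpl R))
  letI algRM : Algebra R M' := c'.toAlgebra
  haveI : IsNoetherianRing (MvPowerSeries (Fin 2 ⊕ Fin m) K) :=
    isNoetherianRing_mvPowerSeries K (Fin 2 ⊕ Fin m)
  haveI : IsNoetherianRing M' := inferInstanceAs (IsNoetherianRing (_ ⧸ _))
  haveI : Module.Flat R M' := by
    have hc : c'.Flat := RingHom.Flat.comp
      (RingHom.flat_algebraMap_iff.mpr (AdicCompletion.flat_of_isNoetherian _))
      (RingHom.Flat.of_bijective eM'.bijective)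
    exact hc
  have hcentre' : P'.map (algebraMap R M') = triplePrime K m ν' i₁ := by
    rw [RingHom.algebraMap_toAlgebra, ← Ideal.map_map]
    exact hJ'
  -- the trace of `Sing`: `Fitt₁ 𝒪̂ ↦ (u, v)` (2.23 Remark), from the residue hypothesis
  letI algAR : Algebra A R := φ'.toAlgebra
  haveI : IsLocalHom (algebraMap A R) := inferInstanceAs (IsLocalHom (q.stalkMap x'₁).hom)
  haveI : Algebra.EssFiniteType A R := LocallyOfFiniteType.stalkMap q x'₁
  let I : Ideal R := Scheme.Hom.singFittingIdeal q x'₁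
  have hI' : Scheme.Hom.singFittingIdeal q x' = I.map (algebraMap R R') :=
    Scheme.Hom.singFittingIdeal_eq_map_stalkSpecializes q hsp'
  have hFitt : (I.map (algebraMap R (Cpl R))).map Ψ.toRingHom =
      Ideal.span {Ideal.Quotient.mk _ (MvPowerSeries.X 0), Ideal.Quotient.mk _ (MvPowerSeries.X 1)} := by
    have hres' : ∀ b : R, ∃ a : A, b - algebraMap A R a ∈ maximalIdeal R := hres
    have hΨ' : ∀ a : A, Ψ (algebraMap R (Cpl R) (algebraMap A R a)) =
        Ideal.Quotient.mk _ (MvPowerSeries.C (algebraMap A (Cpl A) a)) := by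
      intro a
      rw [hof, RingHom.algebraMap_toAlgebra, hΨof a, NodeDeformationRing.ofBase_apply,
        AdicCompletion.algebraMap_apply, Algebra.algebraMap_self_apply]
    exact NodeDeformationRing.map_fittingIdeal_eq_span hres' Ψ hΨ'
  have hIM : I.map (algebraMap R M') = uvIdeal K m ν' := by
    rw [uvIdeal_eq_span, RingHom.algebraMap_toAlgebra, ← Ideal.map_map,
      show eM'.toRingHom = E'.toRingHom.comp Ψ.toRingHom from by rw [heM', RingEquiv.toRingHom_trans],
      ← Ideal.map_map, hFitt, Ideal.map_span, Set.image_pair]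
    change Ideal.span {E' _, E' _} = _
    rw [hE'_X 0, hE'_X 1]
  haveI hP₀ : (triplePrime K m ν' i₁).IsPrime := isPrime_triplePrime K hi₁
  have hunder : (triplePrime K m ν' i₁).comap (algebraMap R M') = P' := by
    have hmin : triplePrime K m ν' i₁ ∈ (P'.map (algebraMap R M')).minimalPrimes := by
      rw [hcentre', Ideal.minimalPrimes_eq_subsingleton_self]
      exact Set.mem_singleton _
    have := under_eq_of_mem_minimalPrimes_map P' hmin
    rwa [Ideal.under_def] at this
  have hunr : (P'.map (algebraMap R M')).map
      (algebraMap M' (Localization.AtPrime (triplePrime K m ν' i₁))) =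
        maximalIdeal (Localization.AtPrime (triplePrime K m ν' i₁)) := by
    rw [hcentre']
    exact Localization.AtPrime.map_eq_maximalIdeal
  have hlen := CodimTwoTransfer.length_quotient_map_eq R' P' (triplePrime K m ν' i₁) hunder hunr I
  change Module.length R' (R' ⧸ Scheme.Hom.singFittingIdeal q x') = _
  rw [hI', ← hlen, hIM]
  exact length_quotient_uvIdeal_localization_triplePrime K hi₁
    (Localization.AtPrime (triplePrime K m ν' i₁))

end Summit.ResolutionOfSingularities.ResolutionOfSingularities.Theorems

end
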